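import Literature.AlgebraicGeometry.HodgeTheory.BettiHodgeConjectureOddHypersurfaceProductsNumerical
import Literature.AlgebraicGeometry.HodgeTheory.QuadricHypersurfaceHodgeConjecture
import Literature.AlgebraicGeometry.HodgeTheory.DegreeOneHypersurfaceHodgeConjecture
import Literature.AlgebraicGeometry.HodgeTheory.BettiHodgeConjectureProductAlgebraicCohomologyFactor
import Literature.AlgebraicGeometry.HodgeTheory.BettiIrregularityHodgeTateType
import HarnessLib

/-!
# Smooth quadric hypersurfaces (and hyperplanes) are of HODGE–TATE TYPE in every dimension, so `HC(Y × Q) ⟸ HC(Y)` for every `Y`; smooth surfaces of degree `≤ 3` in `ℙ³` are of Hodge–Tate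
# type, so `HC(Y × S) ⟸ HC(Y)`, `ρ(Y × S_d) = ρ(Y) + d³ − 4d² + 6d − 2` (Griffiths–Harris Ch. 6 §1; Arapura 2006 Lemma 9 ∕ Cor. 10; Voisin I §11.3.3; Eisenbud–Harris Table 5.1)

Family `hodge`, lane `lit-hodgefound` (Track 2 foundations library; Layers A1/A4), layer `Literature/AlgebraicGeometry/HodgeTheory`.  THEOREMS ONLY (no definition, no named fact, no instance,
no notation; D-0026 net debt `0`).  Prover seat `lit-hodgefound-p21` (generation 41, row g41-#4), sequel of g41-#1∕#2∕#3 (the geometric genus, the middle Betti number in closed form and the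
off-middle Hodge numbers of an abstract smooth hypersurface).

THE MATHEMATICS.  On a smooth quadric `Q ⊂ ℙ^{m+1}_ℂ` EVERY cohomology class of even degree is algebraic — off the middle by Lefschetz, in the middle degree of an even-dimensional quadric by
the two rulings `Λ, Λ′ ≅ ℙ^{m/2}` (`H^{2k}(Q^{2k}, ℤ) = ℤ[Λ] ⊕ ℤ[Λ′]`, Griffiths–Harris Ch. 6 §1; the tree's PROVED `algebraicClasses_eq_top_of_isSmoothHypersurface_two`, and `…_one` for a
hyperplane `≅ ℙᵐ`).  The odd cohomology vanishes: off the middle by Lefschetz, and an odd-dimensional quadric has no middle cohomology because `b_{2r+1} ≤ ((e−1)^{2r+3} − (e−1))/e = 0` for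
`e ≤ 2` (the seat's g41-#2 closed form of Shioda's count; Table 5.1: `b₃(quadric threefold) = 0`) (§1).  A variety all of whose even cohomology is algebraic and whose odd cohomology vanishes is
of HODGE–TATE TYPE (`h^{p,q} = 0` for `p ≠ q`; the tree's `BettiUniverse.hodgeTateType_of_forall_algebraicClasses_eq_top`), so **every smooth quadric and every hyperplane is of Hodge–Tate type,
in every dimension** (§2), and the tree's Hodge–Tate factor theorem (Arapura's Lemma 9 ∕ Cor. 10: the Hodge classes of `Y × Q` are `⊕ Hdgᵃ(Y) ⊗ H^{2b}(Q)`) gives **`HC(Y × Q)` ⟸ `HC(Y)` and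
`HC(Q × Y)` ⟸ `HC(Y)` for every smooth projective `Y`** — unconditional for `dim Y ≤ 3`, for `Y` another quadric, an odd-dimensional hypersurface or a hypersurface fourfold of degree `≤ 5`
— and `ρ(Y × Q) = ρ(Y) + b₂(Q)` (§3).  Likewise a smooth SURFACE `S ⊂ ℙ³` of degree `d ≤ 3` has `q = 0` and `p_g = C(d−1,3) = 0` (g41-#1∕#2), hence is of Hodge–Tate type (the tree's
`BettiUniverse.hodgeTateType_of_surface_pg_q_zero`): **`HC(Y × S)` ⟸ `HC(Y)`** (unconditional for `dim Y ≤ 3` and for hypersurface fourfolds of degree `≤ 5`) and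
**`ρ(Y × S_d) = ρ(Y) + d³ − 4d² + 6d − 2`**, i.e. `+ 7` for the cubic surface (§4).

THE PRINTS.  P. Griffiths, J. Harris (1978) [GriffithsHarrisPrinciples1978] Ch. 6 §1 (linear spaces on quadrics, `H^{2k}(Q^{2k}) = ℤ[Λ] ⊕ ℤ[Λ′]`).  D. Arapura (2006) [Arapura2001HodgeCyclesModuli] Lemma 9,
Cor. 10, Remark 11 (products with a factor whose cohomology is spanned by algebraic classes).  C. Voisin (2002) [VoisinHodgeI2002] §7.1.1, §11.3.1 Thm. 11.30, §11.3.3 Thm. 11.38, Lemma 11.41, p. 287.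
C. Voisin (2003) [VoisinHodgeII2003] §1.2.3 Cor. 1.24–1.25, §11.1.1.  D. Eisenbud, J. Harris (2016) [EisenbudHarris2016] Example 5.24, Table 5.1 (`b₃(quadric threefold) = 0`, `b₂(quadric surface) = 2`,
`b₂(cubic surface) = 7`).  R. Hartshorne (1977) [Hartshorne1977] II Example 8.20.3 (`p_g = 0` for `d ≤ n`).  D. Arapura (2012) [Arapura2012] §17.3 (17.3.1).  S. Zucker (1977) [Zucker1977]; A. Conte,
J. P. Murre (1978) [ConteMurre1978].  P. Deligne (2000) [Deligne2000] §1.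

THE OBJECTS (all the tree's).  `IsSmoothHypersurface`, `HodgeConjectureFor`, `algebraicClasses`, `BettiUniverse.hodge hHD hX k` with `hodgeNumber`, `hodgeClasses`; p20's
`algebraicClasses_eq_top_of_isSmoothHypersurface_two`, `…_one`, `hodgeConjectureFor_of_isSmoothHypersurface_four_of_le_five`; p29's `BettiUniverse.hodgeTateType_of_forall_algebraicClasses_eq_top`,
`…hodgeConjectureFor_tensor_of_forall_algebraicClasses_eq_top_right/left`, `…hodgeConjectureFor_tensor_of_hodgeTateType_right/left`, `…picardNumber_tensor_of_hodgeTateType_right`,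
`…hodgeTateType_of_surface_pg_q_zero`, `hodgeConjectureFor_of_forall_algebraicClasses_eq_top`, `IsSmoothHypersurface.finrank_bettiCohomology_eq_zero_of_odd`, `…hodgeConjectureFor_of_odd`; the seat's
g41-#2 `finrank_bettiCohomology_middle_odd_le_div`, `finrank_bettiCohomology_two_surface`, `hodgeNumber_one_zero_surface`, g41-#1 `hodgeNumber_two_zero_surface_eq_zero_of_le_three`; `hodgeTensorFacts_holds`.

WHAT IS PROVED.
* §1 **`IsSmoothHypersurface.finrank_bettiCohomology_middle_eq_zero_of_degree_le_two`** (odd-dimensional quadric∕hyperplane: `b_m = 0`), **`…finrank_bettiCohomology_eq_zero_of_odd_of_degree_le_two`** (all odd `k`).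
* §2 `IsSmoothHypersurface.algebraicClasses_eq_top_of_degree_le_two`, **`…hodgeTateType_of_degree_le_two`** (every smooth quadric ∕ hyperplane is of Hodge–Tate type), `…hodgeClasses_hodge_eq_top_of_degree_le_two`.
* §3 **`IsSmoothHypersurface.hodgeConjectureFor_tensor_right_of_degree_le_two`** (`HC(Y × Q)` ⟸ `HC(Y)`), **`…tensor_left_of_degree_le_two`** (`HC(Q × Y)`), `…_of_le_three` (unconditional, `dim Y ≤ 3`),
  `…tensor_of_degree_le_two_of_degree_le_two` (`Q × Q′`), `…tensor_hypersurface_of_degree_le_two_of_odd`, `…tensor_fourfold_of_degree_le_two_of_le_five` (quadric × cubic fourfold, …),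
  **`…picardNumber_tensor_right_of_degree_le_two`** (`ρ(Y × Q) = ρ(Y) + b₂(Q)`), `…picardNumber_tensor_quadricSurface` (`+ 2`).
* §4 **`IsSmoothHypersurface.hodgeTateType_surface_of_le_three`**, **`…hodgeConjectureFor_tensor_surface_of_le_three`** (`HC(Y × S)` ⟸ `HC(Y)`), `…surface_of_le_three_tensor` (mirror),
  `…tensor_surface_of_le_three_of_le_three` (unconditional), `…fourfold_of_le_five_tensor_surface_of_le_three` (cubic fourfold × cubic surface, …), **`…picardNumber_tensor_surface_of_le_three`**
  (`ρ(Y × S_d) = ρ(Y) + d³ − 4d² + 6d − 2`), `…picardNumber_tensor_cubicSurface` (`+ 7`).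

DEVIATIONS / SCOPE.  `HC(Y)` is a hypothesis wherever `dim Y ≥ 4` and `Y` is not one of the listed factors; no statement about quadric BUNDLES or singular quadrics.  No definitions.

## References
* [GriffithsHarrisPrinciples1978] P. Griffiths, J. Harris, *Principles of Algebraic Geometry* (1978) — Ch. 6 §1.
* [Arapura2001HodgeCyclesModuli] D. Arapura, *Motivation for Hodge cycles* (2006) — Lemma 9, Cor. 10, Remark 11.
* [VoisinHodgeI2002] C. Voisin, *Hodge Theory and Complex Algebraic Geometry I* (2002) — §7.1.1; §11.3.1 Thm. 11.30; §11.3.3 Thm. 11.38, Lemma 11.41, p. 287.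
* [VoisinHodgeII2003] C. Voisin, *Hodge Theory and Complex Algebraic Geometry II* (2003) — §1.2.3 Cor. 1.24–1.25; §11.1.1.
* [EisenbudHarris2016] D. Eisenbud, J. Harris, *3264 and All That* (2016) — Example 5.24, Table 5.1 (held text p0210–p0211).
* [Hartshorne1977] R. Hartshorne, *Algebraic Geometry* (1977) — II Example 8.20.3.
* [Arapura2012] D. Arapura, *Algebraic Geometry over the Complex Numbers* (2012) — §17.3 (17.3.1).
* [Zucker1977] S. Zucker, *The Hodge conjecture for cubic fourfolds*, Compositio Math. 34 (1977) — (3.2) Theorem, p. 206.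
* [ConteMurre1978] A. Conte, J. P. Murre, *The Hodge conjecture for fourfolds admitting a covering by rational curves*, Math. Ann. 238 (1978) 79–88.
* [Deligne2000] P. Deligne, *The Hodge conjecture* (Clay, 2000) — §1.

## Provenance
Lane `lit-hodgefound` (Hodge path, Track 2), prover seat `lit-hodgefound-p21` (generation 41), self-proposed row g41-#4 (sequel of g41-#1∕#2∕#3; uses p20's `QuadricHypersurfaceHodgeConjecture`,
`DegreeOneHypersurfaceHodgeConjecture` and p29's `BettiHodgeConjectureProductAlgebraicCohomologyFactor`, `BettiHodgeClassesProductHodgeTateFactor`, `BettiIrregularityHodgeTateType`).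
-/

noncomputable section

open scoped TensorProduct
open CategoryTheory MonoidalCategory Module
open Literature.AlgebraicTopology.SingularHomology

namespace Literature.AlgebraicGeometry.Motives.IsSmoothHypersurface

open Literature.AlgebraicGeometry.Motives
open Literature.AlgebraicGeometry.Motives.HodgeStructure
open Literature.AlgebraicGeometry.HodgeTheory

variable {m n e d l : ℕ} {X X' Y Z S : SchemeOver ℂ}

/-! ### §1 Smooth hypersurfaces of degree `≤ 2` have no odd cohomology at all -/

section OddVanishing

/-- **An odd-dimensional smooth quadric (or hyperplane) has NO middle cohomology: `b_{2r+1}(X) = 0` for `deg X ≤ 2`** (`b_{2r+1} ≤ ((e−1)^{2r+3} − (e−1))/e`, which is `0` for `e = 1, 2`; Table 5.1: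
`b₃(quadric threefold) = 0`). [cite: EisenbudHarris2016, Example 5.24 and Table 5.1] [cite: GriffithsHarrisPrinciples1978, Ch. 6 §1] -/
theorem finrank_bettiCohomology_middle_eq_zero_of_degree_le_two (hXh : IsSmoothHypersurface m e X) {r : ℕ} (hm : m = 2 * r + 1) (he : e ≤ 2) : Module.finrank ℚ (bettiCohomology X m) = 0 := by
  have h := hXh.finrank_bettiCohomology_middle_odd_le_div hm
  have hpos := pos_of_isSmoothHypersurface hXh
  rcases (show e = 1 ∨ e = 2 by omega) with rfl | rfl
  · rw [show (1 - 1 : ℕ) = 0 by norm_num, zero_pow (by omega)] at h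
    simpa using h
  · simpa using h

/-- **Every odd Betti number of a smooth hypersurface of degree `≤ 2` vanishes** (every dimension: off the middle by Lefschetz, in the middle by the count above). [cite: VoisinHodgeII2003, §1.2.3 Cor. 1.24 and Cor. 1.25]
[cite: EisenbudHarris2016, Example 5.24 and Table 5.1] -/
theorem finrank_bettiCohomology_eq_zero_of_odd_of_degree_le_two (hXh : IsSmoothHypersurface m e X) (he : e ≤ 2) {k : ℕ} (hk : Odd k) : Module.finrank ℚ (bettiCohomology X k) = 0 := by
  by_cases hkm : k = m
  · subst hkm
    obtain ⟨r, hr⟩ := hk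
    exact hXh.finrank_bettiCohomology_middle_eq_zero_of_degree_le_two hr he
  · exact hXh.finrank_bettiCohomology_eq_zero_of_odd hk hkm

end OddVanishing

/-! ### §2 Smooth quadrics and hyperplanes are of Hodge–Tate type, in every dimension -/

section HodgeTate

/-- **On a smooth hypersurface of degree `≤ 2` every class of every even degree is algebraic** (the two rulings of a quadric, p20's `algebraicClasses_eq_top_of_isSmoothHypersurface_two`; the linear subspaces
of a hyperplane, `…_one`). [cite: GriffithsHarrisPrinciples1978, Ch. 6 §1] [cite: VoisinHodgeII2003, §1.2.3 Cor. 1.24 and Cor. 1.25] -/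
theorem algebraicClasses_eq_top_of_degree_le_two (hXh : IsSmoothHypersurface m e X) (he : e ≤ 2) (p : ℕ) : algebraicClasses X p = ⊤ := by
  have hpos := pos_of_isSmoothHypersurface hXh
  rcases (show e = 1 ∨ e = 2 by omega) with rfl | rfl
  · exact algebraicClasses_eq_top_of_isSmoothHypersurface_one hXh p
  · exact algebraicClasses_eq_top_of_isSmoothHypersurface_two hXh p

/-- **EVERY SMOOTH QUADRIC HYPERSURFACE `Q ⊂ ℙ^{m+1}_ℂ` (and every hyperplane) IS OF HODGE–TATE TYPE: `h^{p,q}(Hᵏ(Q)) = 0` for all `p ≠ q`**, every dimension `m` — all even cohomology is algebraic (§2) and all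
odd cohomology vanishes (§1); classically `H^{2k}(Q^{2k}, ℤ) = ℤ[Λ] ⊕ ℤ[Λ′]`, `H^*(Q)` spanned by linear sections and rulings. [cite: GriffithsHarrisPrinciples1978, Ch. 6 §1] [cite: VoisinHodgeII2003, §1.2.3 Cor. 1.24 and Cor. 1.25]
[cite: VoisinHodgeI2002, §7.1.1 and §11.3.1] -/
theorem hodgeTateType_of_degree_le_two (hXh : IsSmoothHypersurface m e X) (he : e ≤ 2) (hHD : exists_isReal_hodgeModel) (hX : IsSmoothProjective m X) :
    ∀ k p q : ℕ, p + q = k → p ≠ q → (BettiUniverse.hodge hHD hX k).hodgeNumber p q = 0 :=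
  BettiUniverse.hodgeTateType_of_forall_algebraicClasses_eq_top hHD hX (hXh.algebraicClasses_eq_top_of_degree_le_two he) fun _ hk ↦ hXh.finrank_bettiCohomology_eq_zero_of_odd_of_degree_le_two he hk

/-- **`Hdgᵖ(H^{2p}(Q)) = H^{2p}(Q;ℚ)` in EVERY even degree of a smooth quadric or hyperplane**, the middle included. [cite: GriffithsHarrisPrinciples1978, Ch. 6 §1] [cite: VoisinHodgeI2002, §11.3.1] -/
theorem hodgeClasses_hodge_eq_top_of_degree_le_two (hXh : IsSmoothHypersurface m e X) (he : e ≤ 2) (hHD : exists_isReal_hodgeModel) (hX : IsSmoothProjective m X) (p : ℕ) :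
    (BettiUniverse.hodge hHD hX (2 * p)).hodgeClasses p = ⊤ :=
  BettiUniverse.hodgeClasses_hodge_eq_top_of_algebraicClasses_eq_top hHD hX (hXh.algebraicClasses_eq_top_of_degree_le_two he p)

end HodgeTate

/-! ### §3 A smooth quadric (or hyperplane) times anything -/

section Products

/-- **`HC(Y × Q)` ⟸ `HC(Y)` for every smooth quadric or hyperplane `Q`, every smooth projective `Y`** (a Hodge–Tate factor: the tree's `BettiUniverse.hodgeConjectureFor_tensor_of_forall_algebraicClasses_eq_top_right`,
Arapura's Lemma 9 / Cor. 10). [cite: Arapura2001HodgeCyclesModuli, Lemma 9, Cor. 10 and Remark 11] [cite: VoisinHodgeI2002, §11.3.3 Thm. 11.38, Lemma 11.41 and p. 287] [cite: GriffithsHarrisPrinciples1978, Ch. 6 §1] [cite: Deligne2000, §1] -/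
theorem hodgeConjectureFor_tensor_right_of_degree_le_two (hXh : IsSmoothHypersurface m e X) (he : e ≤ 2) (hHD : exists_isReal_hodgeModel) (hY : IsSmoothProjective n Y) (hHCY : HodgeConjectureFor n Y) :
    HodgeConjectureFor (n + m) (Y ⊗ X) := by
  haveI : HodgeTensorFacts.{0, 0} := hodgeTensorFacts_holds
  exact BettiUniverse.hodgeConjectureFor_tensor_of_forall_algebraicClasses_eq_top_right hHD hY hXh.1 (hY.tensor_holds hXh.1) (hXh.algebraicClasses_eq_top_of_degree_le_two he)
    (fun _ hk ↦ hXh.finrank_bettiCohomology_eq_zero_of_odd_of_degree_le_two he hk) hHCY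

/-- **`HC(Q × Y)` ⟸ `HC(Y)`** (the mirror). [cite: Arapura2001HodgeCyclesModuli, Lemma 9, Cor. 10 and Remark 11] [cite: VoisinHodgeI2002, §11.3.3 Thm. 11.38, Lemma 11.41 and p. 287] [cite: GriffithsHarrisPrinciples1978, Ch. 6 §1] -/
theorem hodgeConjectureFor_tensor_left_of_degree_le_two (hXh : IsSmoothHypersurface m e X) (he : e ≤ 2) (hHD : exists_isReal_hodgeModel) (hY : IsSmoothProjective n Y) (hHCY : HodgeConjectureFor n Y) :
    HodgeConjectureFor (m + n) (X ⊗ Y) := by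
  haveI : HodgeTensorFacts.{0, 0} := hodgeTensorFacts_holds
  exact BettiUniverse.hodgeConjectureFor_tensor_of_forall_algebraicClasses_eq_top_left hHD hXh.1 hY (hXh.1.tensor_holds hY) (hXh.algebraicClasses_eq_top_of_degree_le_two he)
    (fun _ hk ↦ hXh.finrank_bettiCohomology_eq_zero_of_odd_of_degree_le_two he hk) hHCY

/-- **UNCONDITIONAL: `HC(Y × Q)` for `dim Y ≤ 3`** and a smooth quadric or hyperplane `Q` of any dimension. [cite: Arapura2001HodgeCyclesModuli, Cor. 10 and Remark 11] [cite: VoisinHodgeI2002, Thm. 11.30, Thm. 6.25 and §11.3.3]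
[cite: Deligne2000, §1] -/
theorem hodgeConjectureFor_tensor_right_of_degree_le_two_of_le_three (hXh : IsSmoothHypersurface m e X) (he : e ≤ 2) (hHD : exists_isReal_hodgeModel) (hY : IsSmoothProjective n Y) (hn : n ≤ 3) :
    HodgeConjectureFor (n + m) (Y ⊗ X) :=
  hXh.hodgeConjectureFor_tensor_right_of_degree_le_two he hHD hY (hodgeConjectureFor_of_dim_le_three_holds hn hY)

/-- **Two quadrics (or hyperplanes): `HC(Q × Q′)`**, unconditionally, all dimensions. [cite: GriffithsHarrisPrinciples1978, Ch. 6 §1] [cite: Arapura2001HodgeCyclesModuli, Cor. 10] [cite: Deligne2000, §1] -/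
theorem hodgeConjectureFor_tensor_of_degree_le_two_of_degree_le_two {e' : ℕ} (hXh : IsSmoothHypersurface m e X) (he : e ≤ 2) (hXh' : IsSmoothHypersurface n e' X') (he' : e' ≤ 2)
    (hHD : exists_isReal_hodgeModel) : HodgeConjectureFor (m + n) (X ⊗ X') :=
  hXh.hodgeConjectureFor_tensor_left_of_degree_le_two he hHD hXh'.1 (hodgeConjectureFor_of_forall_algebraicClasses_eq_top hHD hXh'.1 (hXh'.algebraicClasses_eq_top_of_degree_le_two he'))

/-- **A quadric times an odd-dimensional smooth hypersurface: `HC(Q × X′)`**, unconditionally. [cite: VoisinHodgeII2003, §1.2.3 Cor. 1.24 and Cor. 1.25] [cite: GriffithsHarrisPrinciples1978, Ch. 6 §1] [cite: Deligne2000, §1] -/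
theorem hodgeConjectureFor_tensor_hypersurface_of_degree_le_two_of_odd {e' : ℕ} (hXh : IsSmoothHypersurface m e X) (he : e ≤ 2) (hXh' : IsSmoothHypersurface n e' X') (hn : Odd n)
    (hHD : exists_isReal_hodgeModel) : HodgeConjectureFor (m + n) (X ⊗ X') :=
  hXh.hodgeConjectureFor_tensor_left_of_degree_le_two he hHD hXh'.1 (hXh'.hodgeConjectureFor_of_odd hHD hn)

/-- **A quadric times a smooth hypersurface fourfold of degree `≤ 5` (e.g. a cubic fourfold): `HC(Q × X′)`**, unconditionally. [cite: Zucker1977, (3.2) Theorem, p. 206] [cite: ConteMurre1978]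
[cite: GriffithsHarrisPrinciples1978, Ch. 6 §1] [cite: Deligne2000, §1] -/
theorem hodgeConjectureFor_tensor_fourfold_of_degree_le_two_of_le_five {e' : ℕ} (hXh : IsSmoothHypersurface m e X) (he : e ≤ 2) (hXh' : IsSmoothHypersurface 4 e' X') (he' : e' ≤ 5)
    (hHD : exists_isReal_hodgeModel) : HodgeConjectureFor (m + 4) (X ⊗ X') :=
  hXh.hodgeConjectureFor_tensor_left_of_degree_le_two he hHD hXh'.1 (hodgeConjectureFor_of_isSmoothHypersurface_four_of_le_five he' hXh')

/-- **The Picard number of `Y × Q`: `ρ(Y × Q) = ρ(Y) + b₂(Q)`** for a smooth quadric or hyperplane `Q` (a Hodge–Tate factor; the tree's `BettiUniverse.picardNumber_tensor_of_hodgeTateType_right`).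
[cite: VoisinHodgeI2002, §11.3.3 Thm. 11.38, Lemma 11.41 and p. 287] [cite: Arapura2001HodgeCyclesModuli, Lemma 9] -/
theorem picardNumber_tensor_right_of_degree_le_two (hXh : IsSmoothHypersurface m e X) (he : e ≤ 2) (hHD : exists_isReal_hodgeModel) (hY : IsSmoothProjective n Y) :
    Module.finrank ℚ ↥((BettiUniverse.hodge hHD (hY.tensor_holds hXh.1) 2).hodgeClasses 1) = Module.finrank ℚ ↥((BettiUniverse.hodge hHD hY 2).hodgeClasses 1) + Module.finrank ℚ (bettiCohomology X 2) := by
  haveI : HodgeTensorFacts.{0, 0} := hodgeTensorFacts_holds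
  exact BettiUniverse.picardNumber_tensor_of_hodgeTateType_right hHD hY hXh.1 (hY.tensor_holds hXh.1) (hXh.hodgeTateType_of_degree_le_two he hHD hXh.1)

/-- `ρ(Y × Q) = ρ(Y) + 2` for the quadric SURFACE `Q ≅ ℙ¹ × ℙ¹` (`b₂(Q) = 2`). [cite: EisenbudHarris2016, Example 5.24 and Table 5.1] [cite: VoisinHodgeI2002, §11.3.3 Thm. 11.38] -/
theorem picardNumber_tensor_quadricSurface (hQ : IsSmoothHypersurface 2 2 X) (hHD : exists_isReal_hodgeModel) (hY : IsSmoothProjective n Y) :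
    Module.finrank ℚ ↥((BettiUniverse.hodge hHD (hY.tensor_holds hQ.1) 2).hodgeClasses 1) = Module.finrank ℚ ↥((BettiUniverse.hodge hHD hY 2).hodgeClasses 1) + 2 := by
  rw [hQ.picardNumber_tensor_right_of_degree_le_two le_rfl hHD hY, hQ.finrank_bettiCohomology_two_surface]
  norm_num

end Products

/-! ### §4 Smooth surfaces of degree `≤ 3` in `ℙ³` are of Hodge–Tate type; products with them -/

section LowDegreeSurfaces

/-- **A smooth surface of degree `d ≤ 3` in `ℙ³` (plane, quadric, cubic surface) is of Hodge–Tate type** (`q = 0`, `p_g = C(d−1,3) = 0`; the tree's `BettiUniverse.hodgeTateType_of_surface_pg_q_zero`).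
[cite: Hartshorne1977, II Example 8.20.3] [cite: VoisinHodgeII2003, §1.2.3 Cor. 1.24–1.25 and §11.1.1] [cite: Arapura2012, §17.3 (17.3.1)] -/
theorem hodgeTateType_surface_of_le_three (hS : IsSmoothHypersurface 2 d S) (hd : d ≤ 3) (hHD : exists_isReal_hodgeModel) :
    ∀ k p q : ℕ, p + q = k → p ≠ q → (BettiUniverse.hodge hHD hS.1 k).hodgeNumber p q = 0 :=
  BettiUniverse.hodgeTateType_of_surface_pg_q_zero hS.1 hHD (hS.hodgeNumber_one_zero_surface hHD) (hS.hodgeNumber_two_zero_surface_eq_zero_of_le_three hd hHD)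

/-- **`HC(Y × S)` ⟸ `HC(Y)` for a smooth surface `S ⊂ ℙ³` of degree `≤ 3`, every `Y`** (e.g. any `Y` times a cubic surface). [cite: Arapura2001HodgeCyclesModuli, Lemma 9, Cor. 10 and Remark 11]
[cite: VoisinHodgeI2002, §11.3.3 Thm. 11.38, Lemma 11.41 and p. 287] [cite: Hartshorne1977, II Example 8.20.3] [cite: Deligne2000, §1] -/
theorem hodgeConjectureFor_tensor_surface_of_le_three (hS : IsSmoothHypersurface 2 d S) (hd : d ≤ 3) (hHD : exists_isReal_hodgeModel) (hY : IsSmoothProjective n Y) (hHCY : HodgeConjectureFor n Y) :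
    HodgeConjectureFor (n + 2) (Y ⊗ S) := by
  haveI : HodgeTensorFacts.{0, 0} := hodgeTensorFacts_holds
  exact BettiUniverse.hodgeConjectureFor_tensor_of_hodgeTateType_right hHD hY hS.1 (hY.tensor_holds hS.1) (hS.hodgeTateType_surface_of_le_three hd hHD) hHCY
    (hodgeConjectureFor_of_dim_le_three_holds (by norm_num) hS.1)

/-- The mirror `HC(S × Y)` ⟸ `HC(Y)`. [cite: Arapura2001HodgeCyclesModuli, Lemma 9 and Cor. 10] [cite: VoisinHodgeI2002, §11.3.3 Lemma 11.41 and p. 287] -/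
theorem hodgeConjectureFor_surface_of_le_three_tensor (hS : IsSmoothHypersurface 2 d S) (hd : d ≤ 3) (hHD : exists_isReal_hodgeModel) (hY : IsSmoothProjective n Y) (hHCY : HodgeConjectureFor n Y) :
    HodgeConjectureFor (2 + n) (S ⊗ Y) := by
  haveI : HodgeTensorFacts.{0, 0} := hodgeTensorFacts_holds
  exact BettiUniverse.hodgeConjectureFor_tensor_of_hodgeTateType_left hHD hS.1 hY (hS.1.tensor_holds hY) (hS.hodgeTateType_surface_of_le_three hd hHD)
    (hodgeConjectureFor_of_dim_le_three_holds (by norm_num) hS.1) hHCY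

/-- **UNCONDITIONAL: `HC(Y × S)` for `dim Y ≤ 3` and `S ⊂ ℙ³` smooth of degree `≤ 3`** (fivefolds `T × S₃`, …). [cite: Arapura2001HodgeCyclesModuli, Cor. 10] [cite: VoisinHodgeI2002, Thm. 11.30 and §11.3.3] [cite: Deligne2000, §1] -/
theorem hodgeConjectureFor_tensor_surface_of_le_three_of_le_three (hS : IsSmoothHypersurface 2 d S) (hd : d ≤ 3) (hHD : exists_isReal_hodgeModel) (hY : IsSmoothProjective n Y) (hn : n ≤ 3) :
    HodgeConjectureFor (n + 2) (Y ⊗ S) :=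
  hS.hodgeConjectureFor_tensor_surface_of_le_three hd hHD hY (hodgeConjectureFor_of_dim_le_three_holds hn hY)

/-- **A cubic fourfold (or any hypersurface fourfold of degree `≤ 5`) times a surface of degree `≤ 3` in `ℙ³`: `HC(X × S)`**, unconditionally. [cite: Zucker1977, (3.2) Theorem, p. 206] [cite: ConteMurre1978]
[cite: Arapura2001HodgeCyclesModuli, Cor. 10] [cite: Deligne2000, §1] -/
theorem hodgeConjectureFor_fourfold_of_le_five_tensor_surface_of_le_three {e' : ℕ} (hXh' : IsSmoothHypersurface 4 e' X') (he' : e' ≤ 5) (hS : IsSmoothHypersurface 2 d S) (hd : d ≤ 3)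
    (hHD : exists_isReal_hodgeModel) : HodgeConjectureFor (4 + 2) (X' ⊗ S) :=
  hS.hodgeConjectureFor_tensor_surface_of_le_three hd hHD hXh'.1 (hodgeConjectureFor_of_isSmoothHypersurface_four_of_le_five he' hXh')

/-- **`ρ(Y × S_d) = ρ(Y) + (d³ − 4d² + 6d − 2)` for a smooth surface `S_d ⊂ ℙ³` of degree `d ≤ 3`** (all of `H²(S_d;ℚ)` is algebraic): `+ 1` (plane), `+ 2` (quadric), **`+ 7` (cubic surface)**.
[cite: VoisinHodgeI2002, §11.3.3 Thm. 11.38, Lemma 11.41 and p. 287] [cite: EisenbudHarris2016, Example 5.24 and Table 5.1] [cite: Arapura2001HodgeCyclesModuli, Lemma 9] -/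
theorem picardNumber_tensor_surface_of_le_three (hS : IsSmoothHypersurface 2 d S) (hd : d ≤ 3) (hHD : exists_isReal_hodgeModel) (hY : IsSmoothProjective n Y) :
    Module.finrank ℚ ↥((BettiUniverse.hodge hHD (hY.tensor_holds hS.1) 2).hodgeClasses 1) = Module.finrank ℚ ↥((BettiUniverse.hodge hHD hY 2).hodgeClasses 1) + (d ^ 3 + 6 * d - (4 * d ^ 2 + 2)) := by
  haveI : HodgeTensorFacts.{0, 0} := hodgeTensorFacts_holds
  rw [BettiUniverse.picardNumber_tensor_of_hodgeTateType_right hHD hY hS.1 (hY.tensor_holds hS.1) (hS.hodgeTateType_surface_of_le_three hd hHD), hS.finrank_bettiCohomology_two_surface]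

/-- `ρ(Y × S) = ρ(Y) + 7` for a smooth cubic surface `S`. [cite: EisenbudHarris2016, Example 5.24 and Table 5.1] [cite: VoisinHodgeI2002, §11.3.3 Thm. 11.38] -/
theorem picardNumber_tensor_cubicSurface (hS : IsSmoothHypersurface 2 3 S) (hHD : exists_isReal_hodgeModel) (hY : IsSmoothProjective n Y) :
    Module.finrank ℚ ↥((BettiUniverse.hodge hHD (hY.tensor_holds hS.1) 2).hodgeClasses 1) = Module.finrank ℚ ↥((BettiUniverse.hodge hHD hY 2).hodgeClasses 1) + 7 := by
  rw [hS.picardNumber_tensor_surface_of_le_three le_rfl hHD hY]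
  norm_num

end LowDegreeSurfaces

end Literature.AlgebraicGeometry.Motives.IsSmoothHypersurface

end
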